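import Literature.Probability.RandomPlanarGeometry.SAWPulledBridgeFreeEnergy
import Mathlib.Analysis.MeanInequalities
import Mathlib.Analysis.Convex.Function
import Mathlib.Analysis.SpecialFunctions.Pow.Real
import HarnessLib

/-!
# The pulled-bridge free energy is convex in the log-force: `s ↦ λ_B(e^s)` (lane «FORCE-EXT», R43.1)

Topic `Literature/Probability/RandomPlanarGeometry` (continues `SAWPulledBridgeFreeEnergy.lean`:
`Zd.pulledBridgeFreeEnergy d y = λ_B(y)`, `Zd.tendsto_pulledBridgeFreeEnergy` (Fekete), and
`SAWPulledFreeEnergyZ2.lean` / `SAWPulledBridgeGain.lean`: `Zd.pulledBridgeZ`, `pulledBridgeZ_eq_sum_bridges`,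
`pulledBridgeZ_pos`).

Source / rôle. The pulled (stretched) self-avoiding bridge: `Z^B_N(y) = Σ_{β ∈ SAB_N} y^{span β}`,
`λ_B(y) = lim N⁻¹ log Z^B_N(y)` [Beaton 2015, §3; Janse van Rensburg–Whittington 2016, Thm 3]. As for every
partition function with a linear energy, `s ↦ log Z^B_N(e^s)` is convex (Hölder), hence so is the limit
`s ↦ λ_B(e^s)`; its sub-differential at `s = log y` is the (asymptotic) extension per step under the force
`log y` — the object of the lane's route R43 «FORCE-EXT» (a-idea-1 g9, `Sketch_G9.lean` 7a35a84ae73a8f73, stub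
`stub_R43_1_convex`, the only unproved input of its certified speed window at `y = 2`).

## Contents (namespace `Literature.Probability.RandomPlanarGeometry.SAW.Zd`; every `ℤ^{d+1}`)
* `pulledBridgeZ_exp` — `Z^B_N(e^s) = Σ_{β} e^{s · span β}`;
* `log_pulledBridgeZ_exp_convex` — Hölder: `log Z^B_N(e^{ax+by}) ≤ a log Z^B_N(e^x) + b log Z^B_N(e^y)`;
* **`pulledBridgeFreeEnergy_exp_convexOn`** — `ConvexOn ℝ univ (s ↦ λ_B^{(d+1)}(e^s))` (= `stub_R43_1_convex` for
  `d + 1 = 2`, through `lamB s := pulledBridgeFreeEnergy 2 (exp s)`).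

Printed status: textbook thermodynamic convexity; no novelty claimed (support lemma for R43).
[cite: Beaton2015, §3; MadrasSlade1993, §1.2 (Fekete)]
-/

noncomputable section

open Finset Filter Topology
open scoped BigOperators
open Literature.Probability.LatticeModels Literature.Probability.Percolation

namespace Literature.Probability.RandomPlanarGeometry.SAW.Zd

/-- `Z^B_N(e^s)` as an exponential sum: `Z^B_N(e^s) = Σ_{β ∈ SAB_N} e^{s · span β}`. [cite: Beaton2015, §3] -/
theorem pulledBridgeZ_exp (d N : ℕ) (s : ℝ) :
    pulledBridgeZ (d + 1) N (Real.exp s) = ∑ β ∈ bridges (d + 1) N, Real.exp (s * ((β N 0).toNat : ℝ)) := by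
  rw [pulledBridgeZ_eq_sum_bridges]
  refine Finset.sum_congr rfl fun β _ => ?_
  rw [← Real.exp_nat_mul, mul_comm]

/-- **Hölder on the pulled partition function**: for `a, b ≥ 0`, `a + b = 1`,
`log Z^B_N(e^{a x + b y}) ≤ a log Z^B_N(e^x) + b log Z^B_N(e^y)` (`s ↦ log Z^B_N(e^s)` is convex).
[cite: Beaton2015, §3] -/
theorem log_pulledBridgeZ_exp_convex (d N : ℕ) {x y a b : ℝ} (ha : 0 ≤ a) (hb : 0 ≤ b) (hab : a + b = 1) :
    Real.log (pulledBridgeZ (d + 1) N (Real.exp (a * x + b * y))) ≤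
      a * Real.log (pulledBridgeZ (d + 1) N (Real.exp x)) + b * Real.log (pulledBridgeZ (d + 1) N (Real.exp y)) := by
  have hZx := pulledBridgeZ_pos d N (Real.exp_pos x)
  have hZy := pulledBridgeZ_pos d N (Real.exp_pos y)
  rcases ha.eq_or_lt with rfl | ha0
  · have hb1 : b = 1 := by linarith
    subst hb1; simp
  rcases hb.eq_or_lt with rfl | hb0
  · have ha1 : a = 1 := by linarith
    subst ha1; simp
  have hpq : (a⁻¹).HolderConjugate b⁻¹ := Real.HolderConjugate.inv_inv ha0 hb0 hab
  have key : pulledBridgeZ (d + 1) N (Real.exp (a * x + b * y)) ≤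
      pulledBridgeZ (d + 1) N (Real.exp x) ^ a * pulledBridgeZ (d + 1) N (Real.exp y) ^ b := by
    have h := Real.inner_le_Lp_mul_Lq (bridges (d + 1) N) (fun β => Real.exp (a * (x * ((β N 0).toNat : ℝ))))
      (fun β => Real.exp (b * (y * ((β N 0).toNat : ℝ)))) hpq
    have hf : ∀ β : ℕ → Site (d + 1), |Real.exp (a * (x * ((β N 0).toNat : ℝ)))| ^ a⁻¹ =
        Real.exp (x * ((β N 0).toNat : ℝ)) := by
      intro β
      rw [abs_of_pos (Real.exp_pos _), ← Real.exp_mul, mul_comm a, mul_assoc, mul_inv_cancel₀ ha0.ne', mul_one]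
    have hg : ∀ β : ℕ → Site (d + 1), |Real.exp (b * (y * ((β N 0).toNat : ℝ)))| ^ b⁻¹ =
        Real.exp (y * ((β N 0).toNat : ℝ)) := by
      intro β
      rw [abs_of_pos (Real.exp_pos _), ← Real.exp_mul, mul_comm b, mul_assoc, mul_inv_cancel₀ hb0.ne', mul_one]
    have hfg : ∀ β : ℕ → Site (d + 1), Real.exp (a * (x * ((β N 0).toNat : ℝ))) *
        Real.exp (b * (y * ((β N 0).toNat : ℝ))) = Real.exp ((a * x + b * y) * ((β N 0).toNat : ℝ)) := by
      intro β; rw [← Real.exp_add]; ring_nf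
    simp only [hf, hg, hfg, one_div, inv_inv] at h
    rw [pulledBridgeZ_exp, pulledBridgeZ_exp, pulledBridgeZ_exp]
    exact h
  have hlog := Real.log_le_log (pulledBridgeZ_pos d N (Real.exp_pos _)) key
  rw [Real.log_mul (Real.rpow_pos_of_pos hZx a).ne' (Real.rpow_pos_of_pos hZy b).ne',
    Real.log_rpow hZx, Real.log_rpow hZy] at hlog
  exact hlog

/-- **R43.1 — `s ↦ λ_B(e^s)` is convex on `ℝ`** (every `ℤ^{d+1}`): each `s ↦ N⁻¹ log Z^B_N(e^s)` is convex and
`λ_B(e^s)` is their pointwise limit (`Zd.tendsto_pulledBridgeFreeEnergy`). For `d + 1 = 2` this is the lane's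
`stub_R43_1_convex` (with `lamB s := pulledBridgeFreeEnergy 2 (exp s)`).
[cite: Beaton2015, §3; MadrasSlade1993, §1.2, Lemma 1.2.2 (Fekete)] -/
theorem pulledBridgeFreeEnergy_exp_convexOn (d : ℕ) :
    ConvexOn ℝ Set.univ (fun s : ℝ => pulledBridgeFreeEnergy (d + 1) (Real.exp s)) := by
  refine ⟨convex_univ, fun x _ y _ a b ha hb hab => ?_⟩
  have hlim := fun s : ℝ => tendsto_pulledBridgeFreeEnergy d (Real.exp_pos s)
  have h3 : Tendsto (fun N : ℕ => a * (Real.log (pulledBridgeZ (d + 1) N (Real.exp x)) / N) +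
      b * (Real.log (pulledBridgeZ (d + 1) N (Real.exp y)) / N)) atTop
      (𝓝 (a * pulledBridgeFreeEnergy (d + 1) (Real.exp x) + b * pulledBridgeFreeEnergy (d + 1) (Real.exp y))) :=
    ((hlim x).const_mul a).add ((hlim y).const_mul b)
  refine le_of_tendsto_of_tendsto' (hlim (a • x + b • y)) h3 fun N => ?_
  simp only [smul_eq_mul]
  have h := log_pulledBridgeZ_exp_convex d N (x := x) (y := y) ha hb hab
  have hN : (0 : ℝ) ≤ N := Nat.cast_nonneg N
  calc Real.log (pulledBridgeZ (d + 1) N (Real.exp (a * x + b * y))) / N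
      ≤ (a * Real.log (pulledBridgeZ (d + 1) N (Real.exp x)) + b * Real.log (pulledBridgeZ (d + 1) N (Real.exp y))) / N :=
        div_le_div_of_nonneg_right h hN
    _ = a * (Real.log (pulledBridgeZ (d + 1) N (Real.exp x)) / N) +
        b * (Real.log (pulledBridgeZ (d + 1) N (Real.exp y)) / N) := by ring

end Literature.Probability.RandomPlanarGeometry.SAW.Zd

end
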